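import Summits.Ventures.GridStability.Models.StructurePreservingDAEResync
import Summits.Ventures.GridStability.Models.WSCC9DAELocalMin
import Summits.Ventures.GridStability.Models.NE39DAELocalMin
import HarnessLib

/-!
# GridStability/Models/StructurePreservingDAEResyncInstances — frequency resynchronisation near the typed
# operating points of «WSCC9-DAE» and «NE39-DAE» (damped MV-4 DAE motions): `ωᵢ(t) → ω_s`

LADDER-GRIDFUSION G3/G2 (model register), seat gridfusion-model-2 (g9); `plan/MODEL-VALIDITY.md` row
**MV-4** (c). Instances of `Params.tendsto_speed_of_hessianQuad_pos`
(`StructurePreservingDAEResync.lean`: Barbalat on the printed energy near a pinned strict minimum) on the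
two certified objects: «WSCC9-DAE» (exact in-kernel `LDLᵀ` certificate of the pinned 20 × 20 Hessian,
`WSCC9DAE.hessianQuad_pos`, ★ #130) and «NE39-DAE» (rounded-twin certificate of the pinned 87 × 87
Hessian at the PRINTED Padiyar App. D operating point, `NE39DAE.hessianQuad_pos`, #137). STATEMENT (both):
for every damping vector `D` with `Dᵢ > 0` there is `η > 0` such that every motion of the damped
structure-preserving DAE [cite: SauerPai1998, §7.9.2 eqs (7.193)–(7.196) with the damping torque of §9.2
eq (9.18)] with differentiable bus variables and positive voltages [cite: Padiyar2013, §3.4.4 Comment 1]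
whose pinned initial state is `η`-close to the typed operating point has EVERY machine speed converging to
the synchronous speed, `ωᵢ(t) → ω_s`. THREE COLUMNS: CERTIFIED = the two PD certificates + the kernel
theorems; MODELLED = MV-4 instance tokens (MODEL-VALIDITY v0.49 blocks) + the transplanted damping torque
(a MODELLED VARIANT: (7.194) prints no damping); no rate, no region size, nothing about bus angles or
voltages converging, no sentence about the WSCC or New England systems.
-/

noncomputable section

open Filter
open scoped Topology
open Summit.Ventures.GridStability.Models.StructurePreservingDAE

namespace Summit.Ventures.GridStability.Models

/-- **«WSCC9-DAE»: machine speeds return to synchronous speed** near the typed operating point, for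
every damping `Dᵢ > 0` (damped MV-4 DAE motions with differentiable bus variables and positive
voltages, pinned initial state `η`-close). [cite: Padiyar2013, §3.4.4 eqs (3.32)–(3.40)];
[cite: Leonov2001, Ch. 1 Lemma 1.3] -/
theorem WSCC9DAE.tendsto_speed {D : Fin 3 → ℝ} (hD : ∀ i, 0 < D i) :
    ∃ η > 0, ∀ (δ ω : ℝ → Fin 3 → ℝ) (V θ : ℝ → Fin 9 → ℝ),
      WSCC9DAE.params.IsDampedSolution D δ ω V θ →
      (∀ k, Differentiable ℝ fun t => V t k) → (∀ k, Differentiable ℝ fun t => θ t k) →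
      (∀ t k, 0 < V t k) →
      dist (Params.pinnedState 0 (WSCC9DAE.θ₀ 0) (δ 0) (ω 0) (V 0) (θ 0))
        ((WSCC9DAE.δ₀, fun _ => WSCC9DAE.params.ωs, WSCC9DAE.V₀, WSCC9DAE.θ₀) : Params.PhaseSpace 3 9)
        < η →
      ∀ i, Tendsto (fun t => ω t i) atTop (𝓝 WSCC9DAE.params.ωs) :=
  Params.tendsto_speed_of_hessianQuad_pos WSCC9DAE.wellFormed WSCC9DAE.isOperatingPoint
    (fun k => by show (0 : ℝ) < (WSCC9DAE.VQ k : ℝ); exact_mod_cast WSCC9DAE.VQ_pos k)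
    WSCC9DAE.smoothLoads 0 WSCC9DAE.hessianQuad_pos hD

/-- **«NE39-DAE» (the PRINTED Padiyar App. D operating point): machine speeds return to synchronous
speed** near the operating point, for every damping `Dᵢ > 0` (damped MV-4 DAE motions with
differentiable bus variables and positive voltages, pinned initial state `η`-close).
[cite: Padiyar2013, §3.4.4 eqs (3.32)–(3.40), App. D]; [cite: Leonov2001, Ch. 1 Lemma 1.3] -/
theorem NE39DAE.tendsto_speed {D : Fin 10 → ℝ} (hD : ∀ i, 0 < D i) :
    ∃ η > 0, ∀ (δ ω : ℝ → Fin 10 → ℝ) (V θ : ℝ → Fin 39 → ℝ),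
      NE39DAE.params.IsDampedSolution D δ ω V θ →
      (∀ k, Differentiable ℝ fun t => V t k) → (∀ k, Differentiable ℝ fun t => θ t k) →
      (∀ t k, 0 < V t k) →
      dist (Params.pinnedState 0 (NE39DAE.θ₀ 0) (δ 0) (ω 0) (V 0) (θ 0))
        ((NE39DAE.δ₀, fun _ => NE39DAE.params.ωs, NE39DAE.V₀, NE39DAE.θ₀) : Params.PhaseSpace 10 39)
        < η →
      ∀ i, Tendsto (fun t => ω t i) atTop (𝓝 NE39DAE.params.ωs) :=
  Params.tendsto_speed_of_hessianQuad_pos NE39DAE.wellFormed NE39DAE.isOperatingPoint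
    (fun k => by show (0 : ℝ) < (NE39DAE.VQ k : ℝ); exact_mod_cast NE39DAE.VQ_pos k)
    NE39DAE.smoothLoads 0 NE39DAE.hessianQuad_pos hD

end Summit.Ventures.GridStability.Models

end
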